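import Summits.Ventures.HodgeRepro.EngineBridge
import Summits.Ventures.HodgeRepro.Night3FaceClosureGSet

/-!
# The sealed census rows as twist covers of the faces: engine ↔ `(G, c)` model

Blind re-derivation cell `pub-hodge-repro`, seat `night-3` (gen 3).  Imports p2's `EngineBridge` (the sealer's
Cayley-table engine read in typer's finite-group model: `Elt Γ`, `finsetOf`, `finsetOf_flipAt` / `finsetOf_bar` /
`finsetOf_twist` / `finsetOf_placeMask`, `isCMType_iff`) and night-3's `Night3FaceClosureGSet` (`faceCornersMul`).
Namespace `HodgeRepro.Night3.Census`.

`coversFaces Γ reps` is a closed `Bool` computation on the engine: every face `(T; π, π′)` of the table `Γ` has a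
corner list which is a permutation of the `g_j`-twist of the corner list of some representative in `reps`.  The
transport theorem `cover_of_coversFaces` reads it in the model: for every CM type `Φ ⊆ Elt Γ` and `p' ∉ place c p`
the corner multiset `faceCornersMul c Φ p p'` is a right twist `N·g` of the corner multiset `N = cornersMul Γ r` of
some representative `r ∈ reps`.  With `coversFaces Γ reps = true` decided for a sealed row (its `reps`), this is the
hypothesis `hcover` of night-3's twist reduction (`alg_of_faces_gset_reps`, `Night3FaceClosureTwist.lean`): S4 on the
sealed representatives' corner products ⟹ S4 for every corner product of that `(G, c)`.  Nothing here closes S4; no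
sealed file is touched; no Tier-2 item depends on this file.
-/

set_option autoImplicit false

namespace HodgeRepro.Night3.Census

open Summit.Ventures.HodgeRepro.FaceCensus
open HodgeRepro.EngineBridge
open Finset
open scoped Pointwise symmDiff

variable {n : ℕ}

/-! ### The engine-level cover check -/

/-- The sorted `g_j`-twist of a corner list (sorted, so that lists with the same members in the same multiplicities
compare equal; no duplicates are removed). -/
def twistSort (Γ : CMGaloisType n) (j : Fin n) (L : List ℕ) : List ℕ := sortNat (L.map (Γ.twist j))

/-- All sorted twists of the representatives' corner lists. -/
def repTwists (Γ : CMGaloisType n) (reps : List (ℕ × ℕ × ℕ)) : List (List ℕ) :=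
  reps.flatMap fun r => (List.finRange n).map fun j => twistSort Γ j (Γ.corners r)

/-- The cover test over the CM types in `Ts` against a list `R` of sorted corner lists: every face `(T; p, q)` with
`T ∈ Ts` and `p ≠ q` places has its sorted corner list in `R`. -/
def coversTypes (Γ : CMGaloisType n) (R : List (List ℕ)) (Ts : List ℕ) : Bool :=
  Ts.all fun T => Γ.places.all fun p => Γ.places.all fun q =>
    (q == p) || R.contains (sortNat (Γ.corners (T, p, q)))

/-- **The cover check** (closed `Bool` computation): every face of the engine has a corner list which is a permutation
of the `g_j`-twist of the corner list of some representative. -/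
def coversFaces (Γ : CMGaloisType n) (reps : List (ℕ × ℕ × ℕ)) : Bool :=
  coversTypes Γ (repTwists Γ reps) Γ.cmTypes

/-- The cover test splits along `++` (used to check the order-`12` rows in chunks of CM types). -/
theorem coversTypes_append (Γ : CMGaloisType n) (R : List (List ℕ)) (l₁ l₂ : List ℕ) :
    coversTypes Γ R (l₁ ++ l₂) = true ↔ coversTypes Γ R l₁ = true ∧ coversTypes Γ R l₂ = true := by
  simp only [coversTypes, List.all_append, Bool.and_eq_true]

/-- `coversFaces` from four chunks of CM types (`take 16`, then three more). -/
theorem coversFaces_of_chunks (Γ : CMGaloisType n) (reps : List (ℕ × ℕ × ℕ))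
    (h0 : coversTypes Γ (repTwists Γ reps) (Γ.cmTypes.take 16) = true)
    (h1 : coversTypes Γ (repTwists Γ reps) ((Γ.cmTypes.drop 16).take 16) = true)
    (h2 : coversTypes Γ (repTwists Γ reps) (((Γ.cmTypes.drop 16).drop 16).take 16) = true)
    (h3 : coversTypes Γ (repTwists Γ reps) (((Γ.cmTypes.drop 16).drop 16).drop 16) = true) :
    coversFaces Γ reps = true := by
  unfold coversFaces
  have e : Γ.cmTypes = Γ.cmTypes.take 16 ++ ((Γ.cmTypes.drop 16).take 16 ++
      ((((Γ.cmTypes.drop 16).drop 16).take 16) ++ ((Γ.cmTypes.drop 16).drop 16).drop 16)) := by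
    simp only [List.take_append_drop]
  rw [e, coversTypes_append, coversTypes_append, coversTypes_append]
  exact ⟨h0, h1, h2, h3⟩

/-- The corner multiset of an engine face, read in the model. -/
def cornersMul (Γ : CMGaloisType n) (f : ℕ × ℕ × ℕ) : Multiset (Finset (Elt Γ)) :=
  ((Γ.corners f).map (finsetOf Γ) : List (Finset (Elt Γ)))

/-! ### Sorting is a permutation -/

/-- Sorted insertion is a permutation of `cons`. -/
theorem insertNat_perm (a : ℕ) (l : List ℕ) : List.Perm (insertNat a l) (a :: l) := by
  induction l with
  | nil => simp [insertNat]
  | cons x l ih =>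
    unfold insertNat
    split_ifs
    · exact List.Perm.refl _
    · exact (List.Perm.cons x ih).trans (List.Perm.swap a x l)

/-- Insertion sort is a permutation. -/
theorem sortNat_perm (l : List ℕ) : List.Perm (sortNat l) l := by
  induction l with
  | nil => simp [sortNat]
  | cons x l ih =>
    show List.Perm (insertNat x (sortNat l)) (x :: l)
    exact (insertNat_perm x (sortNat l)).trans (List.Perm.cons x ih)

/-! ### Membership in the engine's lists -/

/-- Membership in a sorted insertion. -/
theorem mem_insertNat {a b : ℕ} {l : List ℕ} : a ∈ insertNat b l ↔ a = b ∨ a ∈ l := by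
  induction l with
  | nil => simp [insertNat]
  | cons x l ih =>
    unfold insertNat
    split_ifs
    · simp
    · rw [List.mem_cons, ih, List.mem_cons]
      tauto

/-- Insertion sort keeps the members. -/
theorem mem_sortNat {a : ℕ} {l : List ℕ} : a ∈ sortNat l ↔ a ∈ l := by
  induction l with
  | nil => simp [sortNat]
  | cons x l ih =>
    show a ∈ insertNat x (sortNat l) ↔ _
    rw [mem_insertNat, ih, List.mem_cons]

/-- `normalize` keeps the members. -/
theorem mem_normalize {a : ℕ} {l : List ℕ} : a ∈ normalize l ↔ a ∈ l := by
  show a ∈ (sortNat l).eraseDups ↔ _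
  rw [List.mem_eraseDups, mem_sortNat]

/-- The place mask of every index is one of the engine's places. -/
theorem placeMask_mem_places (Γ : CMGaloisType n) (i : Fin n) : Γ.placeMask i ∈ Γ.places := by
  show Γ.placeMask i ∈ normalize ((List.finRange n).map Γ.placeMask)
  rw [mem_normalize, List.mem_map]
  exact ⟨i, List.mem_finRange i, rfl⟩

/-- A CM type with two distinct place masks is one of the engine's faces. -/
theorem mem_faces (Γ : CMGaloisType n) {T : ℕ} (hT : Γ.isCMType T = true) (i i' : Fin n)
    (hne : Γ.placeMask i' ≠ Γ.placeMask i) : (T, Γ.placeMask i, Γ.placeMask i') ∈ Γ.faces := by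
  have hTlt : T < 2 ^ n := by
    simp only [CMGaloisType.isCMType, Bool.and_eq_true, decide_eq_true_eq] at hT
    exact hT.1
  unfold CMGaloisType.faces
  rw [List.mem_flatMap]
  refine ⟨T, ?_, ?_⟩
  · unfold CMGaloisType.cmTypes
    rw [List.mem_filter, List.mem_range]
    exact ⟨hTlt, hT⟩
  · rw [List.mem_flatMap]
    refine ⟨Γ.placeMask i, placeMask_mem_places Γ i, ?_⟩
    rw [List.mem_map]
    refine ⟨Γ.placeMask i', ?_, rfl⟩
    rw [List.mem_filter]
    exact ⟨placeMask_mem_places Γ i', by simpa using hne⟩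

/-! ### Masks are onto the finsets -/

/-- The finset of `T ||| bit i` is `insert g_i (finsetOf T)`. -/
theorem finsetOf_or_bit (Γ : CMGaloisType n) (T : ℕ) (i : Fin n) :
    finsetOf Γ (T ||| bit i) = insert (Elt.ofIdx Γ i) (finsetOf Γ T) := by
  ext k
  rw [Finset.mem_insert, mem_finsetOf, mem_finsetOf]
  simp only [mem_eq, Nat.testBit_or, Bool.or_eq_true]
  rw [← mem_eq, ← mem_eq, EngineBridge.mem_bit]
  constructor
  · rintro (h | h)
    · exact Or.inr h
    · exact Or.inl (by rw [← h]; rfl)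
  · rintro (h | h)
    · exact Or.inr (by rw [h]; rfl)
    · exact Or.inl h

/-- Every finset of `Elt Γ` is the finset of a mask below `2 ^ n`. -/
theorem exists_finsetOf (Γ : CMGaloisType n) (Φ : Finset (Elt Γ)) :
    ∃ T : ℕ, T < 2 ^ n ∧ finsetOf Γ T = Φ := by
  induction Φ using Finset.induction_on with
  | empty =>
    refine ⟨0, by positivity, ?_⟩
    ext k
    simp [mem_finsetOf, mem_eq]
  | insert a s _ ih =>
    obtain ⟨T, hT, rfl⟩ := ih
    refine ⟨T ||| bit (Elt.idx Γ a), ?_, ?_⟩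
    · refine Nat.or_lt_two_pow hT ?_
      exact Nat.pow_lt_pow_right (by norm_num) (Elt.idx Γ a).isLt
    · rw [finsetOf_or_bit]
      rfl

/-! ### The transport -/

section Good

variable (Γ : CMGaloisType n) [Fact (Γ.isCMGaloisType = true)]

/-- The engine's corners of `(T; placeMask i, placeMask i')`, read in the model, are the model's face corners. -/
theorem cornersMul_eq (T : ℕ) (i i' : Fin n) :
    cornersMul Γ (T, Γ.placeMask i, Γ.placeMask i') =
      GSet.faceCornersMul (Elt.conj Γ) (finsetOf Γ T) (Elt.ofIdx Γ i) (Elt.ofIdx Γ i') := by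
  simp only [cornersMul, CMGaloisType.corners, List.map_cons, List.map_nil, finsetOf_flipAt, finsetOf_bar,
    finsetOf_placeMask]
  rfl

/-- Distinct places have distinct place masks. -/
theorem placeMask_ne {p p' : Elt Γ} (hp : p' ∉ place (Elt.conj Γ) p) :
    Γ.placeMask (Elt.idx Γ p') ≠ Γ.placeMask (Elt.idx Γ p) := by
  intro h
  apply hp
  have := congrArg (finsetOf Γ) h
  rw [finsetOf_placeMask, finsetOf_placeMask] at this
  change place (Elt.conj Γ) p' = place (Elt.conj Γ) p at this
  rw [← this]
  exact mem_place_self _ _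

/-- The twisted corner multiset, read in the model, is the right twist of the corner multiset. -/
theorem cornersMul_twist (r : ℕ × ℕ × ℕ) (j : Fin n) :
    (((Γ.corners r).map (Γ.twist j)).map (finsetOf Γ) : List (Finset (Elt Γ))) =
      ((Γ.corners r).map (finsetOf Γ)).map fun S => rmul S (Elt.ofIdx Γ j) := by
  simp only [List.map_map]
  refine List.map_congr_left fun T _ => ?_
  exact finsetOf_twist Γ j T

/-- **The transport**: if `coversFaces Γ reps = true`, then for every CM type `Φ` of the model and `p' ∉ place c p` the
corner multiset of the face `(Φ; p, p')` is a right twist of the corner multiset of some representative. -/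
theorem cover_of_coversFaces (reps : List (ℕ × ℕ × ℕ)) (h : coversFaces Γ reps = true)
    (Φ : Finset (Elt Γ)) (p p' : Elt Γ) (hΦ : IsCMType (Elt.conj Γ) Φ) (hp : p' ∉ place (Elt.conj Γ) p) :
    ∃ r ∈ reps, ∃ g : Elt Γ,
      GSet.faceCornersMul (Elt.conj Γ) Φ p p' = (cornersMul Γ r).map fun S => rmul S g := by
  obtain ⟨T, hTlt, rfl⟩ := exists_finsetOf Γ Φ
  have hT : Γ.isCMType T = true := (isCMType_iff Γ T).2 ⟨hTlt, hΦ⟩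
  have hTmem : T ∈ Γ.cmTypes := by
    unfold CMGaloisType.cmTypes
    rw [List.mem_filter, List.mem_range]
    exact ⟨hTlt, hT⟩
  have hne := placeMask_ne Γ hp
  simp only [coversFaces, coversTypes, List.all_eq_true] at h
  have h' := h T hTmem _ (placeMask_mem_places Γ (Elt.idx Γ p)) _ (placeMask_mem_places Γ (Elt.idx Γ p'))
  rw [Bool.or_eq_true, beq_iff_eq] at h'
  rcases h' with h' | h'
  · exact absurd h' hne
  rw [List.contains_iff_mem, repTwists, List.mem_flatMap] at h'
  obtain ⟨r, hr, h'⟩ := h'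
  rw [List.mem_map] at h'
  obtain ⟨j, -, hj⟩ := h'
  refine ⟨r, hr, Elt.ofIdx Γ j, ?_⟩
  -- the two corner lists are permutations of each other
  have hperm : List.Perm (Γ.corners (T, Γ.placeMask (Elt.idx Γ p), Γ.placeMask (Elt.idx Γ p')))
      ((Γ.corners r).map (Γ.twist j)) := by
    refine (sortNat_perm _).symm.trans ?_
    rw [← hj, twistSort]
    exact sortNat_perm _
  have hperm' := hperm.map (finsetOf Γ)
  rw [← Multiset.coe_eq_coe] at hperm'
  have e1 : (((Γ.corners (T, Γ.placeMask (Elt.idx Γ p), Γ.placeMask (Elt.idx Γ p'))).map (finsetOf Γ) :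
      List (Finset (Elt Γ))) : Multiset (Finset (Elt Γ))) =
      GSet.faceCornersMul (Elt.conj Γ) (finsetOf Γ T) p p' := cornersMul_eq Γ T _ _
  rw [e1, cornersMul_twist] at hperm'
  rw [hperm', cornersMul]
  simp only [Multiset.map_coe]

end Good

end HodgeRepro.Night3.Census
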